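import Literature.Algebra.Homology.ProductCocycles
import Mathlib.LinearAlgebra.Matrix.Determinant.Basic
import Mathlib.GroupTheory.Perm.Fin
import HarnessLib

/-!
# Alternating evaluation of cochains at commuting tuples

Topic `Algebra/Homology`; namespace `Literature.Algebra.Homology`.  Mathlib + `ProductCocycles`;
definitions with bodies and theorems.

For a group `G`, a field `k` (trivial action) and a tuple `g = (g₁, …, gₙ)` of elements of `G`, the
ALTERNATING EVALUATION of an inhomogeneous `n`-cochain `f`,

  `Alt_g(f) = ∑_{σ ∈ 𝔖ₙ} sgn(σ) f(g_{σ(1)}, …, g_{σ(n)})`  (`altEval g`),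

is a linear functional which

* VANISHES ON COBOUNDARIES when the `gᵢ` commute pairwise (`altEval_d_eq_zero`: the inner faces
  cancel in pairs `σ ↔ σ ∘ (j j+1)`, the two outer faces cancel after the cyclic shift
  `σ ↔ σ ∘ (1 2 ⋯ n+1)`), hence is well defined on `Hⁿ(G, k)` for abelian `G` (the pairing with the
  Pontryagin product `g₁ ∧ ⋯ ∧ gₙ ∈ Λⁿ G ⊆ Hₙ(G)`);
* evaluates a product cocycle to a DETERMINANT: `Alt_g(θ₁ ∪ ⋯ ∪ θₙ) = det (θᵢ(g_a))_{a,i}`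
  (`altEval_prodCochain`);
* so that for a "dual pair" `θ'ⱼ(b_l) = δ_{jl}` and `n`-subsets `I, J` (strictly increasing
  `Fin n ↪o Fin d`) one gets `Alt_{b_J}(θ'_{I}) = δ_{IJ}` (`altEval_prodCochain_dual`).

With `ProductCocycles` this yields the linear independence of the `(d choose n)` classes
`[θ'_{I(1)} ∪ ⋯ ∪ θ'_{I(n)}]` in `Hⁿ(ℤ^d, k)` [Brown1982CohomologyGroups, V §6], the lower bound in
`H•(ℤ^d, k) = Λ•(k^d)`.

## References

* K. S. Brown, *Cohomology of Groups*, GTM 87 (1982), V §6 [Brown1982CohomologyGroups].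
-/

noncomputable section

open CategoryTheory groupCohomology

universe u

namespace Literature.Algebra.Homology

variable {k G : Type u} [Field k] [Group G]

/-! ### The alternating evaluation -/

/-- **`Alt_g(f) = ∑_σ sgn(σ) f(g ∘ σ)`**, a linear functional on `n`-cochains. [folklore] -/
def altEval {n : ℕ} (g : Fin n → G) : ((Fin n → G) → k) →ₗ[k] k where
  toFun f := ∑ σ : Equiv.Perm (Fin n), ((Equiv.Perm.sign σ : ℤ) : k) * f (g ∘ σ)
  map_add' f f' := by
    simp only [Pi.add_apply, mul_add, Finset.sum_add_distrib]
  map_smul' a f := by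
    simp only [Pi.smul_apply, smul_eq_mul, RingHom.id_apply, Finset.mul_sum]
    exact Finset.sum_congr rfl fun σ _ => by ring

omit [Group G] in
/-- Unfolding `altEval`. [folklore] -/
theorem altEval_apply {n : ℕ} (g : Fin n → G) (f : (Fin n → G) → k) :
    altEval g f = ∑ σ : Equiv.Perm (Fin n), ((Equiv.Perm.sign σ : ℤ) : k) * f (g ∘ σ) :=
  rfl

/-! ### Vanishing on coboundaries at commuting tuples -/

/-- Contracting at `j` is blind to swapping the two contracted (commuting) entries. [folklore] -/
theorem contractNth_comp_swap {n : ℕ} (g : Fin (n + 1) → G) (hg : ∀ a b, g a * g b = g b * g a)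
    (σ : Equiv.Perm (Fin (n + 1))) (j' : Fin n) :
    (Fin.castSucc j').contractNth (· * ·) (g ∘ ⇑(σ * Equiv.swap (Fin.castSucc j') j'.succ)) =
      (Fin.castSucc j').contractNth (· * ·) (g ∘ ⇑σ) := by
  have hne : (Fin.castSucc j' : Fin (n + 1)) ≠ j'.succ := fun h => by
    have := congrArg Fin.val h
    simp at this
  funext i
  rcases lt_trichotomy (i : ℕ) (j' : ℕ) with hlt | heq | hgt
  · rw [Fin.contractNth_apply_of_lt _ _ _ _ (by simpa using hlt),
      Fin.contractNth_apply_of_lt _ _ _ _ (by simpa using hlt)]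
    simp only [Function.comp_apply, Equiv.Perm.coe_mul]
    rw [Equiv.swap_apply_of_ne_of_ne]
    · exact fun h => by have := congrArg Fin.val h; simp at this; omega
    · exact fun h => by have := congrArg Fin.val h; simp at this; omega
  · have hi : i = j' := Fin.ext heq
    subst hi
    rw [Fin.contractNth_apply_of_eq _ _ _ _ (by simp), Fin.contractNth_apply_of_eq _ _ _ _ (by simp)]
    simp only [Function.comp_apply, Equiv.Perm.coe_mul]
    rw [Equiv.swap_apply_left, Equiv.swap_apply_right, hg]
  · rw [Fin.contractNth_apply_of_gt _ _ _ _ (by simpa using hgt),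
      Fin.contractNth_apply_of_gt _ _ _ _ (by simpa using hgt)]
    simp only [Function.comp_apply, Equiv.Perm.coe_mul]
    rw [Equiv.swap_apply_of_ne_of_ne]
    · exact fun h => by have := congrArg Fin.val h; simp at this; omega
    · exact fun h => by have := congrArg Fin.val h; simp at this; omega

/-- **The inner faces cancel**: `∑_σ sgn(σ) h(…, g_{σ(j)} g_{σ(j+1)}, …) = 0` for commuting `gᵢ`.
[folklore] -/
theorem sum_sign_contractNth_castSucc {n : ℕ} (g : Fin (n + 1) → G) (hg : ∀ a b, g a * g b = g b * g a)
    (h : (Fin n → G) → k) (j' : Fin n) :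
    ∑ σ : Equiv.Perm (Fin (n + 1)), ((Equiv.Perm.sign σ : ℤ) : k) *
      h ((Fin.castSucc j').contractNth (· * ·) (g ∘ σ)) = 0 := by
  classical
  have hne : (Fin.castSucc j' : Fin (n + 1)) ≠ j'.succ := fun h => by
    have := congrArg Fin.val h
    simp at this
  refine Finset.sum_involution (fun σ _ => σ * Equiv.swap (Fin.castSucc j') j'.succ) ?_ ?_ ?_ ?_
  · intro σ _
    rw [contractNth_comp_swap g hg σ j', Equiv.Perm.sign_mul, Equiv.Perm.sign_swap hne, ← add_mul,
      Units.val_mul, Int.cast_mul]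
    simp
  · intro σ _ _ h
    have : Equiv.swap (Fin.castSucc j') j'.succ = 1 := mul_left_cancel (h.trans (mul_one σ).symm)
    exact hne (Equiv.swap_eq_one_iff.1 this)
  · intro σ _
    exact Finset.mem_univ _
  · intro σ _
    rw [mul_assoc, Equiv.swap_mul_self, mul_one]

/-- **The outer faces match after a cyclic shift**:
`∑_σ sgn(σ) h(g_{σ(1)}, …, g_{σ(n)}) = (−1)ⁿ ∑_σ sgn(σ) h(g_{σ(2)}, …, g_{σ(n+1)})`. [folklore] -/
theorem sum_sign_contractNth_last {n : ℕ} (g : Fin (n + 1) → G) (h : (Fin n → G) → k) :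
    ∑ σ : Equiv.Perm (Fin (n + 1)), ((Equiv.Perm.sign σ : ℤ) : k) *
      h ((Fin.last n).contractNth (· * ·) (g ∘ σ)) =
      (-1 : k) ^ n * ∑ σ : Equiv.Perm (Fin (n + 1)), ((Equiv.Perm.sign σ : ℤ) : k) * h (fun i => g (σ i.succ)) := by
  classical
  have hinit : ∀ σ : Equiv.Perm (Fin (n + 1)), (Fin.last n).contractNth (· * ·) (g ∘ σ) =
      fun i => g (σ (Fin.castSucc i)) := fun σ => by
    funext i
    rw [Fin.contractNth_apply_of_lt _ _ _ _ (by simp)]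
    rfl
  simp_rw [hinit]
  -- reindex `σ ↦ σ * finRotate`
  rw [← Fintype.sum_equiv (Equiv.mulRight (finRotate (n + 1)))
    (fun σ => ((Equiv.Perm.sign (σ * finRotate (n + 1)) : ℤ) : k) *
      h (fun i => g ((σ * finRotate (n + 1)) (Fin.castSucc i))))
    (fun σ => ((Equiv.Perm.sign σ : ℤ) : k) * h (fun i => g (σ (Fin.castSucc i)))) (fun σ => rfl),
    Finset.mul_sum]
  refine Finset.sum_congr rfl fun σ _ => ?_
  have hrot : (fun i : Fin n => g ((σ * finRotate (n + 1)) (Fin.castSucc i))) = fun i => g (σ i.succ) := by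
    funext i
    rw [Equiv.Perm.mul_apply, finRotate_apply, Fin.coeSucc_eq_succ]
  rw [hrot, Equiv.Perm.sign_mul, sign_finRotate, Nat.add_sub_cancel, Units.val_mul, Units.val_pow_eq_pow_val,
    Units.val_neg, Units.val_one, Int.cast_mul, Int.cast_pow, Int.cast_neg, Int.cast_one]
  ring

/-- **`Alt_g` vanishes on coboundaries** for pairwise commuting `g₀, …, gₙ` (trivial coefficients).
[cite: Brown1982CohomologyGroups, V §6] -/
theorem altEval_d_eq_zero {n : ℕ} (g : Fin (n + 1) → G) (hg : ∀ a b, g a * g b = g b * g a)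
    (h : (Fin n → G) → k) : altEval g (inhomogeneousCochains.d (trivRep k G) n h) = 0 := by
  classical
  rw [altEval_apply]
  have hd : ∀ σ : Equiv.Perm (Fin (n + 1)), inhomogeneousCochains.d (trivRep k G) n h (g ∘ σ) =
      h (fun i => g (σ i.succ)) + ∑ j : Fin (n + 1), (-1 : k) ^ ((j : ℕ) + 1) * h (j.contractNth (· * ·) (g ∘ σ)) := by
    intro σ
    rw [inhomogeneousCochains.d_hom_apply]
    rfl
  simp_rw [hd, mul_add, Finset.sum_add_distrib, Finset.mul_sum]
  rw [Finset.sum_comm]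
  simp_rw [mul_left_comm _ ((-1 : k) ^ _), ← Finset.mul_sum]
  rw [Fin.sum_univ_castSucc]
  simp_rw [sum_sign_contractNth_castSucc g hg h, mul_zero, Finset.sum_const_zero, zero_add]
  rw [sum_sign_contractNth_last, Fin.val_last, ← mul_assoc, ← pow_add,
    show n + 1 + n = 2 * n + 1 by ring, pow_succ, pow_mul]
  simp

/-! ### Product cocycles evaluate to determinants -/

/-- The cochain underlying `prodCocycle θ` is `prodCochain θ`. [folklore] -/
theorem iCocycles_prodCocycle {n : ℕ} (θ : Fin n → (Additive G →+ k)) :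
    iCocycles (trivRep k G) n (prodCocycle θ) = prodCochain θ :=
  iCocycles_mk _ _

/-- **`Alt_g(θ₁ ∪ ⋯ ∪ θₙ) = det (θᵢ(g_a))_{a,i}`.** [cite: Brown1982CohomologyGroups, V §6] -/
theorem altEval_prodCochain {n : ℕ} (g : Fin n → G) (θ : Fin n → (Additive G →+ k)) :
    altEval g (prodCochain θ) = (Matrix.of fun a i => θ i (Additive.ofMul (g a))).det := by
  rw [altEval_apply, Matrix.det_apply]
  refine Finset.sum_congr rfl fun σ _ => ?_
  rw [Units.smul_def, zsmul_eq_mul, prodCochain_apply]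
  rfl

/-- **Dual pairs give the identity matrix of evaluations**: if `θ'ⱼ(b_l) = δ_{jl}` then for
`n`-subsets `I, J` (strictly increasing maps `Fin n ↪o Fin d`),
`Alt_{b ∘ J}(θ'_{I(1)} ∪ ⋯ ∪ θ'_{I(n)}) = δ_{IJ}`. [cite: Brown1982CohomologyGroups, V §6] -/
theorem altEval_prodCochain_dual {d n : ℕ} [DecidableEq (Fin n ↪o Fin d)] (b : Fin d → G) (θ' : Fin d → (Additive G →+ k))
    (hdual : ∀ j l, θ' j (Additive.ofMul (b l)) = if j = l then 1 else 0) (I J : Fin n ↪o Fin d) :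
    altEval (b ∘ J) (prodCochain fun i => θ' (I i)) = if I = J then 1 else 0 := by
  classical
  rw [altEval_prodCochain]
  by_cases hIJ : I = J
  · subst hIJ
    rw [if_pos rfl]
    have hM : (Matrix.of fun a i => θ' (I i) (Additive.ofMul ((b ∘ I) a))) = (1 : Matrix (Fin n) (Fin n) k) := by
      ext a i
      rw [Matrix.of_apply, Function.comp_apply, hdual, Matrix.one_apply]
      by_cases hai : a = i
      · subst hai; simp
      · rw [if_neg (fun h => hai (I.injective h).symm), if_neg hai]
    rw [hM, Matrix.det_one]
  · rw [if_neg hIJ]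
    -- some `J a` is not in the range of `I`
    have hex : ∃ a, ∀ i, I i ≠ J a := by
      by_contra hcon
      push Not at hcon
      apply hIJ
      have hsub : Finset.univ.image J ⊆ Finset.univ.image I := by
        intro x hx
        obtain ⟨a, -, rfl⟩ := Finset.mem_image.1 hx
        obtain ⟨i, hi⟩ := hcon a
        exact Finset.mem_image.2 ⟨i, Finset.mem_univ _, hi⟩
      have hcard : (Finset.univ.image I).card ≤ (Finset.univ.image J).card := by
        rw [Finset.card_image_of_injective _ I.injective, Finset.card_image_of_injective _ J.injective]
      have heq := Finset.eq_of_subset_of_card_le hsub hcard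
      have hrange : Set.range J = Set.range I := by
        rw [← Set.image_univ, ← Set.image_univ, ← Finset.coe_univ, ← Finset.coe_image, ← Finset.coe_image, heq]
      exact (OrderEmbedding.range_inj.1 hrange.symm)
    obtain ⟨a, ha⟩ := hex
    refine Matrix.det_eq_zero_of_row_eq_zero a fun i => ?_
    rw [Matrix.of_apply, Function.comp_apply, hdual, if_neg (ha i)]

end Literature.Algebra.Homology

end
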